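import Summits.QuantumFields.YangMills.Theorems.BalabanUVNodesN07PlateCaccioppoliBiharmonicCore
import HarnessLib

/-!
# DAG node N07 — the ONE-STEP INTERIOR PLATE-ENERGY ESTIMATE for discrete BIHARMONIC functions on the torus
# (hole-filling form `E(inner) ≤ ½·E(outer) + K(d)·δ⁴·Σ_outer h²`), geometry carried as hypotheses: road item (L2) ∕ socket (S3)

Width seat `pub-ymgap-dag-n07-w7` (g6), count-neutral helper (`--supports … --as helper`); sequel of this seat's
`…Theorems.BalabanUVNodesN07PlateCaccioppoli` (p635306: `plate_caccioppoli_core`, `neg_sum_lap_mul_mul_le`,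
`dirichlet_interpolation`) on g3's calculus (`fd`, `bd`, `lap` on `TorusSite d N`).

WHAT.  For `h` with `Δ²h = 0` wherever a cut-off `χ` lives, `|∂χ| ≤ δ`, `|∂∂χ| ≤ δ²`, and a second cut-off `ψ ∈ [0,1]` with
`|∂ψ| ≤ δ`, equal to `1` on the radius-2 neighbourhood of the set where `χ` varies, and supported together with its
1-neighbourhood in a finset `M`:
  ★★★ `biharmonic_plate_step`:  `Σ_x χ(x)²(Δh(x))² ≤ ½·Σ_{x∈M} (Δh(x))² + 8464·d²·δ⁴·Σ_{x∈M} h(x)²`.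
This is the hypothesis of the hole-filling ∕ Giaquinta iteration (θ = ½, exponent 4; the tree's
`Literature.Analysis.PDE.GiaquintaIterationLemma.lemma_V_3_1`), which turns it into the interior estimate
`Σ_{B_ρ}(Δh)² ≤ C(d)(r−ρ)⁻⁴Σ_{B_r}h²` once box cut-offs on `TorusSite` with the stated bounds are supplied (NOT in this file:
no geometry is constructed here — every geometric fact enters as a hypothesis on `χ`, `ψ`, `M`).
* §1 the SCALE-CORRECT transport bound: `transport_eq_grad_form` (`K_χu(x) = Σᵢ[∂ᵢχ(x)(∂ᵢu(x)+∂ᵢu(x−eᵢ)) + ∂ᵢ∂ᵢχ(x−eᵢ)·u(x−eᵢ)]`),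
  `transport_sq_le_grad` (`(K_χu)² ≤ 3d·Σᵢ[(∂ᵢχ)²(∂ᵢu)² + (∂ᵢχ)²(∂ᵢu(·−eᵢ))² + (∂ᵢ∂ᵢχ(·−eᵢ))²u(·−eᵢ)²]`, replacing p635306's
  `transport_sq_le` whose `(∂χ)²u²` weight is off by `δ⁻²` in scale);
* §2 pointwise domination tools (`sq_mul_le_of_dom`, `abs_sq_sub_sq_le`, `mul_abs_mul_abs_le`, `sum_sq_mul_le_sum_mem`);
* §3 `transport_sum_le`, `weight_fwd_le` ∕ `weight_bwd_le` (the two error terms of p635306's `plate_caccioppoli_core`, dominated),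
  ★★ `plate_energy_le_of_biharmonic` (`Σχ²(Δh)² ≤ 32d·δ²·D_ψ + 16d²·δ⁴·H_ψ` with the ψ-dominated gradient ∕ mass sums
  `D_ψ = ΣⱼΣ_x(ψ(x)²+ψ(x+eⱼ)²)(∂ⱼh(x))²`, `H_ψ = Σ_x ψ(x)²h(x)²`), ★★★ `biharmonic_plate_step`.

HONEST SCOPE.  Finite-difference algebra, Young and Cauchy–Schwarz on one torus; asserts NOTHING about [B11]∕[B6]∕[3]; the box
cut-offs, the iteration, the orders 1 and 3, the robust one-level inequality in x-space and the assembly (S4)–(S5) of the road are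
NOT here; (P)_D for Bałaban's `d = 4` geometries OPEN; `hker` at the record, stub 1, K0⁷ ∕ K1⁹ NOT closed; N07 not discharged;
nothing continuum ∕ OS ∕ mass gap.  Context only (no hypothesis is a citation): M. Giaquinta, *Multiple integrals in the calculus
of variations and nonlinear elliptic systems* (1983) Ch. III §2, Ch. V Lemma 3.1 [Giaquinta1984]; T. Bałaban, CMP **96** (1984)
223–250 [Balaban1984PropagatorsII] (1.9), (2.22).

FILE SPLIT (400-line cap): §1, §2 and `transport_sum_le` ∕ `weight_fwd_le` live in the CORE file
`…N07PlateCaccioppoliBiharmonicCore`; this file is the second half of §3.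
-/

set_option autoImplicit false

noncomputable section

open Finset

namespace Summit.QuantumFields.YangMills.Theorems.N07PlateCaccioppoliBiharmonic

open Literature.Probability.LatticeModels (TorusSite)
open Summit.QuantumFields.YangMills.Theorems.N07PointFeasibilityEnergyIdentity (fd bd lap sum_shift sum_shift_sub
  bd_eq_fd_sub)
open Summit.QuantumFields.YangMills.Theorems.N07PlateCaccioppoli (plate_caccioppoli_core neg_sum_lap_mul_mul_le
  dirichlet_interpolation)

variable {d N : ℕ}

/-! ## §3 (continued)  The plate energy of a biharmonic function under a cut-off -/

section Biharmonic

variable [NeZero N]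

/-- The backward weight pairing, dominated (one direction `i`): the mirror image of `weight_fwd_le`. [folklore] -/
theorem weight_bwd_le (h χ ψ : TorusSite d N → ℝ) {δ : ℝ}
    (hχ1 : ∀ i x, |fd i χ x| ≤ δ) (hχ2 : ∀ i j x, |fd j (fd i χ) x| ≤ δ ^ 2)
    (hχψ : ∀ i y, fd i χ y ≠ 0 → ψ y = 1 ∧ (∀ k : Fin d, ψ (y + Pi.single k 1) = 1 ∧ ψ (y - Pi.single k 1) = 1) ∧
      (∀ k l : Fin d, ψ (y + Pi.single k 1 + Pi.single l 1) = 1 ∧ ψ (y + Pi.single k 1 - Pi.single l 1) = 1 ∧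
        ψ (y - Pi.single k 1 - Pi.single l 1) = 1)) (i : Fin d) :
    ∑ j, ∑ x : TorusSite d N, (bd i χ (x + Pi.single j 1) ^ 2 * (fd j h (x - Pi.single i 1) ^ 2 + fd j h x ^ 2) / 2 +
        |fd j (fun y => bd i χ y ^ 2) x| * |h (x - Pi.single i 1)| * |fd j h x|) ≤
      2 * δ ^ 2 * ∑ j, ∑ x : TorusSite d N, (ψ x ^ 2 + ψ (x + Pi.single j 1) ^ 2) * fd j h x ^ 2 +
        d * δ ^ 4 * ∑ x : TorusSite d N, ψ x ^ 2 * h x ^ 2 := by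
  set H : ℝ := ∑ x : TorusSite d N, ψ x ^ 2 * h x ^ 2 with hH
  have hsq1 : ∀ i x, fd i χ x ^ 2 ≤ δ ^ 2 := fun i x => by
    have := hχ1 i x; rw [← sq_abs]; exact pow_le_pow_left₀ (abs_nonneg _) this 2
  have hbd : ∀ y, bd i χ y = fd i χ (y - Pi.single i 1) := fun y => bd_eq_fd_sub i χ y
  have perj : ∀ j : Fin d, ∑ x : TorusSite d N, (bd i χ (x + Pi.single j 1) ^ 2 * (fd j h (x - Pi.single i 1) ^ 2 + fd j h x ^ 2) / 2 +
      |fd j (fun y => bd i χ y ^ 2) x| * |h (x - Pi.single i 1)| * |fd j h x|) ≤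
      2 * δ ^ 2 * ∑ x : TorusSite d N, (ψ x ^ 2 + ψ (x + Pi.single j 1) ^ 2) * fd j h x ^ 2 + δ ^ 4 * H := by
    intro j
    have ea : ∑ x : TorusSite d N, (ψ x ^ 2 + ψ (x + Pi.single j 1) ^ 2) * fd j h x ^ 2 =
        ∑ x : TorusSite d N, (ψ (x - Pi.single i 1) ^ 2 + ψ (x - Pi.single i 1 + Pi.single j 1) ^ 2) *
          fd j h (x - Pi.single i 1) ^ 2 :=
      (sum_shift_sub (fun x => (ψ x ^ 2 + ψ (x + Pi.single j 1) ^ 2) * fd j h x ^ 2) (Pi.single i 1)).symm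
    have pa : ∑ x : TorusSite d N, bd i χ (x + Pi.single j 1) ^ 2 * fd j h (x - Pi.single i 1) ^ 2 ≤
        δ ^ 2 * ∑ x : TorusSite d N, (ψ x ^ 2 + ψ (x + Pi.single j 1) ^ 2) * fd j h x ^ 2 := by
      rw [ea, Finset.mul_sum]
      refine Finset.sum_le_sum (fun x _ => ?_)
      rw [hbd]
      have hw : fd i χ (x + Pi.single j 1 - Pi.single i 1) ≠ 0 →
          1 ≤ ψ (x - Pi.single i 1) ^ 2 + ψ (x - Pi.single i 1 + Pi.single j 1) ^ 2 := fun hne => by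
        have h1 := ((hχψ i _ hne).2.1 j).2
        rw [show x + Pi.single j 1 - Pi.single i 1 - Pi.single j 1 = x - Pi.single i 1 by abel] at h1
        rw [h1]; nlinarith [sq_nonneg (ψ (x - Pi.single i 1 + Pi.single j 1))]
      have := sq_mul_le_of_dom hw (hsq1 i _) (sq_nonneg (fd j h (x - Pi.single i 1))) (by positivity)
      linarith
    have pb : ∑ x : TorusSite d N, bd i χ (x + Pi.single j 1) ^ 2 * fd j h x ^ 2 ≤
        δ ^ 2 * ∑ x : TorusSite d N, (ψ x ^ 2 + ψ (x + Pi.single j 1) ^ 2) * fd j h x ^ 2 := by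
      rw [Finset.mul_sum]
      refine Finset.sum_le_sum (fun x _ => ?_)
      rw [hbd]
      have hw : fd i χ (x + Pi.single j 1 - Pi.single i 1) ≠ 0 → 1 ≤ ψ x ^ 2 + ψ (x + Pi.single j 1) ^ 2 :=
        fun hne => by
        have h1 := ((hχψ i _ hne).2.2 i j).2.1
        rw [show x + Pi.single j 1 - Pi.single i 1 + Pi.single i 1 - Pi.single j 1 = x by abel] at h1
        rw [h1]; nlinarith [sq_nonneg (ψ (x + Pi.single j 1))]
      have := sq_mul_le_of_dom hw (hsq1 i _) (sq_nonneg (fd j h x)) (by positivity)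
      linarith
    have pc : ∑ x : TorusSite d N, |fd j (fun y => bd i χ y ^ 2) x| * |h (x - Pi.single i 1)| * |fd j h x| ≤
        δ ^ 4 * H + δ ^ 2 * ∑ x : TorusSite d N, (ψ x ^ 2 + ψ (x + Pi.single j 1) ^ 2) * fd j h x ^ 2 := by
      have eH : H = ∑ x : TorusSite d N, ψ (x - Pi.single i 1) ^ 2 * h (x - Pi.single i 1) ^ 2 :=
        (sum_shift_sub (fun x => ψ x ^ 2 * h x ^ 2) (Pi.single i 1)).symm
      rw [eH, Finset.mul_sum, Finset.mul_sum, ← Finset.sum_add_distrib]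
      refine Finset.sum_le_sum (fun x _ => ?_)
      have hshift : x + Pi.single j 1 - Pi.single i 1 = x - Pi.single i 1 + Pi.single j 1 := by abel
      have hc : |fd j (fun y => bd i χ y ^ 2) x| ≤ 2 * δ ^ 3 := by
        have h2' : |fd i χ (x + Pi.single j 1 - Pi.single i 1) - fd i χ (x - Pi.single i 1)| ≤ δ ^ 2 := by
          have := hχ2 i j (x - Pi.single i 1)
          simp only [fd] at this ⊢
          rw [hshift]; exact this
        have := abs_sq_sub_sq_le (hχ1 i (x - Pi.single i 1)) (hχ1 i (x + Pi.single j 1 - Pi.single i 1)) h2'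
        simpa only [fd, hbd] using this
      have hy := mul_abs_mul_abs_le (p := h (x - Pi.single i 1)) (q := fd j h x) hc
      by_cases hz : fd j (fun y => bd i χ y ^ 2) x = 0
      · rw [hz, abs_zero, zero_mul, zero_mul]; positivity
      · have hvar : fd i χ (x + Pi.single j 1 - Pi.single i 1) ≠ 0 ∨ fd i χ (x - Pi.single i 1) ≠ 0 := by
          by_contra hcon; push Not at hcon
          apply hz; simp only [fd, hbd] at hcon ⊢; rw [hcon.1, hcon.2]; ring
        have hψ1 : ψ (x - Pi.single i 1) = 1 := by
          rcases hvar with h1 | h1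
          · have := ((hχψ i _ h1).2.1 j).2
            rwa [show x + Pi.single j 1 - Pi.single i 1 - Pi.single j 1 = x - Pi.single i 1 by abel] at this
          · exact (hχψ i _ h1).1
        have hψ2 : ψ x = 1 := by
          rcases hvar with h1 | h1
          · have := ((hχψ i _ h1).2.2 i j).2.1
            rwa [show x + Pi.single j 1 - Pi.single i 1 + Pi.single i 1 - Pi.single j 1 = x by abel] at this
          · have := ((hχψ i _ h1).2.1 i).1; rwa [sub_add_cancel] at this
        rw [hψ1, hψ2]
        have hnn : 0 ≤ δ ^ 2 * (ψ (x + Pi.single j 1) ^ 2 * fd j h x ^ 2) := by positivity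
        have e2 : δ ^ 4 * ((1 : ℝ) ^ 2 * h (x - Pi.single i 1) ^ 2) + δ ^ 2 * ((1 ^ 2 + ψ (x + Pi.single j 1) ^ 2) * fd j h x ^ 2) =
            (δ ^ 4 * h (x - Pi.single i 1) ^ 2 + δ ^ 2 * fd j h x ^ 2) + δ ^ 2 * (ψ (x + Pi.single j 1) ^ 2 * fd j h x ^ 2) := by
          ring
        rw [e2]
        linarith [hy, hnn]
    have split : ∑ x : TorusSite d N, (bd i χ (x + Pi.single j 1) ^ 2 * (fd j h (x - Pi.single i 1) ^ 2 + fd j h x ^ 2) / 2 +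
        |fd j (fun y => bd i χ y ^ 2) x| * |h (x - Pi.single i 1)| * |fd j h x|) =
        (1 / 2) * (∑ x : TorusSite d N, bd i χ (x + Pi.single j 1) ^ 2 * fd j h (x - Pi.single i 1) ^ 2) +
        (1 / 2) * (∑ x : TorusSite d N, bd i χ (x + Pi.single j 1) ^ 2 * fd j h x ^ 2) +
        ∑ x : TorusSite d N, |fd j (fun y => bd i χ y ^ 2) x| * |h (x - Pi.single i 1)| * |fd j h x| := by
      rw [Finset.mul_sum, Finset.mul_sum, ← Finset.sum_add_distrib, ← Finset.sum_add_distrib]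
      exact Finset.sum_congr rfl (fun x _ => by ring)
    rw [split]
    linarith [pa, pb, pc]
  calc _ ≤ ∑ j : Fin d, (2 * δ ^ 2 * ∑ x : TorusSite d N, (ψ x ^ 2 + ψ (x + Pi.single j 1) ^ 2) * fd j h x ^ 2 + δ ^ 4 * H) :=
        Finset.sum_le_sum (fun j _ => perj j)
    _ = _ := by
        rw [Finset.sum_add_distrib, ← Finset.mul_sum, Finset.sum_const, Finset.card_univ, Fintype.card_fin,
          nsmul_eq_mul]; ring

/-- ★★ **Localised plate energy of a biharmonic function.**  If `Δ²h = 0` wherever `χ ≠ 0` (and the standing hypotheses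
hold) then `Σ_x χ²(Δh)² ≤ 32d·δ²·D_ψ + 16d²·δ⁴·H_ψ` (p635306's `plate_caccioppoli_core` with the forcing pairing zero,
`transport_sum_le`, `weight_fwd_le`, `weight_bwd_le`). [folklore] -/
theorem plate_energy_le_of_biharmonic (h χ ψ : TorusSite d N → ℝ) {δ : ℝ}
    (hχ1 : ∀ i x, |fd i χ x| ≤ δ) (hχ2 : ∀ i j x, |fd j (fd i χ) x| ≤ δ ^ 2)
    (hχψ : ∀ i y, fd i χ y ≠ 0 → ψ y = 1 ∧ (∀ k : Fin d, ψ (y + Pi.single k 1) = 1 ∧ ψ (y - Pi.single k 1) = 1) ∧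
      (∀ k l : Fin d, ψ (y + Pi.single k 1 + Pi.single l 1) = 1 ∧ ψ (y + Pi.single k 1 - Pi.single l 1) = 1 ∧
        ψ (y - Pi.single k 1 - Pi.single l 1) = 1))
    (hbi : ∀ x, χ x ≠ 0 → lap (lap h) x = 0) :
    ∑ x : TorusSite d N, χ x ^ 2 * lap h x ^ 2 ≤
      32 * d * δ ^ 2 * ∑ j, ∑ x : TorusSite d N, (ψ x ^ 2 + ψ (x + Pi.single j 1) ^ 2) * fd j h x ^ 2 +
        16 * d ^ 2 * δ ^ 4 * ∑ x : TorusSite d N, ψ x ^ 2 * h x ^ 2 := by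
  set D : ℝ := ∑ j, ∑ x : TorusSite d N, (ψ x ^ 2 + ψ (x + Pi.single j 1) ^ 2) * fd j h x ^ 2 with hD
  set H : ℝ := ∑ x : TorusSite d N, ψ x ^ 2 * h x ^ 2 with hH
  have core := plate_caccioppoli_core χ h
  have hF : ∑ x : TorusSite d N, χ x ^ 2 * h x * lap (lap h) x = 0 := by
    refine Finset.sum_eq_zero (fun x _ => ?_)
    by_cases hx : χ x = 0
    · rw [hx]; ring
    · rw [hbi x hx]; ring
  have hK := transport_sum_le h χ ψ hχ1 hχ2 hχψ
  -- the weight term, direction by direction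
  have e : ∑ x : TorusSite d N, lap h x * ∑ i, ((χ (x + Pi.single i 1) - χ x) ^ 2 * h (x + Pi.single i 1) +
        (χ (x - Pi.single i 1) - χ x) ^ 2 * h (x - Pi.single i 1)) =
      ∑ i, (∑ x : TorusSite d N, lap h x * (fd i χ x ^ 2 * h (x + Pi.single i 1)) +
        ∑ x : TorusSite d N, lap h x * (bd i χ x ^ 2 * h (x - Pi.single i 1))) := by
    have pt : ∀ x, lap h x * ∑ i, ((χ (x + Pi.single i 1) - χ x) ^ 2 * h (x + Pi.single i 1) +
        (χ (x - Pi.single i 1) - χ x) ^ 2 * h (x - Pi.single i 1)) =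
        ∑ i, (lap h x * (fd i χ x ^ 2 * h (x + Pi.single i 1)) + lap h x * (bd i χ x ^ 2 * h (x - Pi.single i 1))) := by
      intro x
      rw [Finset.mul_sum]
      refine Finset.sum_congr rfl (fun i _ => ?_)
      simp only [fd, bd]; ring
    rw [Finset.sum_congr rfl (fun x _ => pt x), Finset.sum_comm]
    exact Finset.sum_congr rfl (fun i _ => Finset.sum_add_distrib)
  have sp : ∀ (i j : Fin d) (x : TorusSite d N),
      fd j (fun y => h (y + Pi.single i 1)) x = fd j h (x + Pi.single i 1) := by
    intro i j x; simp only [fd, add_right_comm x (Pi.single j 1) (Pi.single i 1)]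
  have sm : ∀ (i j : Fin d) (x : TorusSite d N),
      fd j (fun y => h (y - Pi.single i 1)) x = fd j h (x - Pi.single i 1) := by
    intro i j x; simp only [fd, sub_add_eq_add_sub]
  have hG : ∀ i : Fin d,
      -(∑ x : TorusSite d N, lap h x * (fd i χ x ^ 2 * h (x + Pi.single i 1)) +
        ∑ x : TorusSite d N, lap h x * (bd i χ x ^ 2 * h (x - Pi.single i 1))) ≤ 4 * δ ^ 2 * D + 2 * d * δ ^ 4 * H := by
    intro i
    have hp := neg_sum_lap_mul_mul_le (fun y => fd i χ y ^ 2) (fun y => h (y + Pi.single i 1)) h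
      (fun y => sq_nonneg _)
    have hm := neg_sum_lap_mul_mul_le (fun y => bd i χ y ^ 2) (fun y => h (y - Pi.single i 1)) h
      (fun y => sq_nonneg _)
    beta_reduce at hp hm
    simp only [sp, sm] at hp hm
    have hp' := weight_fwd_le h χ ψ hχ1 hχ2 hχψ i
    have hm' := weight_bwd_le h χ ψ hχ1 hχ2 hχψ i
    linarith [hp, hm, hp', hm']
  have hGsum := Finset.sum_le_sum (fun i (_ : i ∈ (Finset.univ : Finset (Fin d))) => hG i)
  rw [Finset.sum_neg_distrib, ← e, Finset.sum_const, Finset.card_univ, Fintype.card_fin, nsmul_eq_mul] at hGsum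
  rw [hF] at core
  have e4 : (24 * d * δ ^ 2 * D + 12 * d ^ 2 * δ ^ 4 * H) + 2 * (d * (4 * δ ^ 2 * D + 2 * d * δ ^ 4 * H)) =
      32 * d * δ ^ 2 * D + 16 * d ^ 2 * δ ^ 4 * H := by ring
  linarith [core, hK, hGsum, e4]

/-- ★★★ **THE ONE-STEP INTERIOR PLATE-ENERGY ESTIMATE FOR DISCRETE BIHARMONIC FUNCTIONS** (hole-filling form).
Let `Δ²h = 0` wherever `χ ≠ 0`; `|∂χ| ≤ δ`, `|∂∂χ| ≤ δ²`; `ψ ∈ [0,1]` with `|∂ψ| ≤ δ`, `ψ = 1` on the radius-2 neighbourhood of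
every point where `χ` varies, and `ψ` supported together with its 1-neighbourhood in the finset `M`.  Then
`Σ_x χ(x)²(Δh(x))² ≤ ½·Σ_{x∈M} (Δh(x))² + 8464·d²·δ⁴·Σ_{x∈M} h(x)²`.
With box cut-offs of width `w` (`δ = 2∕w`) this is `E(ρ) ≤ ½E(r) + C(d)(r−ρ)⁻⁴Σ_{B_r}h²`, the hypothesis of Giaquinta's
iteration lemma (`Literature.Analysis.PDE.GiaquintaIterationLemma.lemma_V_3_1`, θ = ½, α = 4). [folklore] -/
theorem biharmonic_plate_step (h χ ψ : TorusSite d N → ℝ) {δ : ℝ} (hδ : 0 < δ) (hd : 0 < d)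
    (M : Finset (TorusSite d N))
    (hbi : ∀ x, χ x ≠ 0 → lap (lap h) x = 0)
    (hχ1 : ∀ i x, |fd i χ x| ≤ δ) (hχ2 : ∀ i j x, |fd j (fd i χ) x| ≤ δ ^ 2)
    (hχψ : ∀ i y, fd i χ y ≠ 0 → ψ y = 1 ∧ (∀ k : Fin d, ψ (y + Pi.single k 1) = 1 ∧ ψ (y - Pi.single k 1) = 1) ∧
      (∀ k l : Fin d, ψ (y + Pi.single k 1 + Pi.single l 1) = 1 ∧ ψ (y + Pi.single k 1 - Pi.single l 1) = 1 ∧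
        ψ (y - Pi.single k 1 - Pi.single l 1) = 1))
    (hψ01 : ∀ x, 0 ≤ ψ x ∧ ψ x ≤ 1) (hψ1 : ∀ i x, |fd i ψ x| ≤ δ)
    (hM : ∀ x, ψ x ≠ 0 → x ∈ M ∧ ∀ k : Fin d, x + Pi.single k 1 ∈ M ∧ x - Pi.single k 1 ∈ M) :
    ∑ x : TorusSite d N, χ x ^ 2 * lap h x ^ 2 ≤
      (1 / 2) * ∑ x ∈ M, lap h x ^ 2 + 8464 * d ^ 2 * δ ^ 4 * ∑ x ∈ M, h x ^ 2 := by
  classical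
  have hd0 : (0 : ℝ) < d := by exact_mod_cast hd
  set D : ℝ := ∑ j, ∑ x : TorusSite d N, (ψ x ^ 2 + ψ (x + Pi.single j 1) ^ 2) * fd j h x ^ 2 with hD
  set H : ℝ := ∑ x : TorusSite d N, ψ x ^ 2 * h x ^ 2 with hH
  set EM : ℝ := ∑ x ∈ M, lap h x ^ 2 with hEM
  set HM : ℝ := ∑ x ∈ M, h x ^ 2 with hHM
  have hHM0 : 0 ≤ HM := Finset.sum_nonneg (fun x _ => sq_nonneg _)
  have A := plate_energy_le_of_biharmonic h χ ψ hχ1 hχ2 hχψ hbi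
  -- interpolation for the ψ-gradient sum, with t = 1/(128 d δ²)
  set t : ℝ := 1 / (128 * d * δ ^ 2) with ht
  have htpos : 0 < t := by rw [ht]; positivity
  have I := dirichlet_interpolation ψ h htpos
  -- localise the three ψ-sums on M
  have L1 : ∑ x : TorusSite d N, ψ x ^ 2 * lap h x ^ 2 ≤ EM :=
    sum_sq_mul_le_sum_mem ψ (fun x => lap h x ^ 2) M hψ01 (fun x hx => (hM x hx).1) (fun x => sq_nonneg _)
  have L2 : H ≤ HM :=
    sum_sq_mul_le_sum_mem ψ (fun x => h x ^ 2) M hψ01 (fun x hx => (hM x hx).1) (fun x => sq_nonneg _)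
  have L3 : ∑ j, ∑ x : TorusSite d N, fd j ψ x ^ 2 * (h x + h (x + Pi.single j 1)) ^ 2 ≤ 4 * d * δ ^ 2 * HM := by
    have perj : ∀ j : Fin d, ∑ x : TorusSite d N, fd j ψ x ^ 2 * (h x + h (x + Pi.single j 1)) ^ 2 ≤ 4 * δ ^ 2 * HM := by
      intro j
      have s1 : ∑ x : TorusSite d N, fd j ψ x ^ 2 * (h x + h (x + Pi.single j 1)) ^ 2 ≤
          ∑ x : TorusSite d N, ((if x ∈ M then 2 * δ ^ 2 * h x ^ 2 else 0) +
            (if x + Pi.single j 1 ∈ M then 2 * δ ^ 2 * h (x + Pi.single j 1) ^ 2 else 0)) := by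
        refine Finset.sum_le_sum (fun x _ => ?_)
        have hz1 : 0 ≤ (if x ∈ M then 2 * δ ^ 2 * h x ^ 2 else 0) := by split_ifs <;> positivity
        have hz2 : 0 ≤ (if x + Pi.single j 1 ∈ M then 2 * δ ^ 2 * h (x + Pi.single j 1) ^ 2 else 0) := by
          split_ifs <;> positivity
        by_cases hz : fd j ψ x = 0
        · rw [hz]; simp only [ne_eq, OfNat.ofNat_ne_zero, not_false_eq_true, zero_pow, zero_mul]
          linarith
        · have hvar : ψ x ≠ 0 ∨ ψ (x + Pi.single j 1) ≠ 0 := by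
            by_contra hcon; push Not at hcon; apply hz; simp only [fd, hcon.1, hcon.2, sub_zero]
          have hx1 : x ∈ M := by
            rcases hvar with h1 | h1
            · exact (hM x h1).1
            · have := ((hM _ h1).2 j).2; rwa [add_sub_cancel_right] at this
          have hx2 : x + Pi.single j 1 ∈ M := by
            rcases hvar with h1 | h1
            · exact ((hM x h1).2 j).1
            · exact (hM _ h1).1
          rw [if_pos hx1, if_pos hx2]
          have hsq : fd j ψ x ^ 2 ≤ δ ^ 2 := by
            have := hψ1 j x; rw [← sq_abs]; exact pow_le_pow_left₀ (abs_nonneg _) this 2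
          have hab : (h x + h (x + Pi.single j 1)) ^ 2 ≤ 2 * (h x ^ 2 + h (x + Pi.single j 1) ^ 2) := by
            nlinarith [sq_nonneg (h x - h (x + Pi.single j 1))]
          calc fd j ψ x ^ 2 * (h x + h (x + Pi.single j 1)) ^ 2
              ≤ δ ^ 2 * (2 * (h x ^ 2 + h (x + Pi.single j 1) ^ 2)) :=
                mul_le_mul hsq hab (sq_nonneg _) (by positivity)
            _ = 2 * δ ^ 2 * h x ^ 2 + 2 * δ ^ 2 * h (x + Pi.single j 1) ^ 2 := by ring
      have s2 : ∑ x : TorusSite d N, ((if x ∈ M then 2 * δ ^ 2 * h x ^ 2 else 0) +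
          (if x + Pi.single j 1 ∈ M then 2 * δ ^ 2 * h (x + Pi.single j 1) ^ 2 else 0)) = 4 * δ ^ 2 * HM := by
        rw [Finset.sum_add_distrib]
        rw [sum_shift (fun y => if y ∈ M then 2 * δ ^ 2 * h y ^ 2 else 0) (Pi.single j 1)]
        rw [Finset.sum_ite_mem, Finset.univ_inter, ← Finset.mul_sum]
        ring
      linarith
    calc ∑ j, ∑ x : TorusSite d N, fd j ψ x ^ 2 * (h x + h (x + Pi.single j 1)) ^ 2 ≤ ∑ _j : Fin d, 4 * δ ^ 2 * HM :=
        Finset.sum_le_sum (fun j _ => perj j)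
      _ = 4 * d * δ ^ 2 * HM := by
          rw [Finset.sum_const, Finset.card_univ, Fintype.card_fin, nsmul_eq_mul]; ring
  -- assemble: 32 d δ² D ≤ ½ EM + (8192 + 256) d² δ⁴ HM
  have key : 32 * d * δ ^ 2 * D ≤ (1 / 2) * EM + 8448 * d ^ 2 * δ ^ 4 * HM := by
    have c1 : 32 * d * δ ^ 2 * (2 * t) = 1 / 2 := by rw [ht]; field_simp; ring
    have c2 : 32 * d * δ ^ 2 * (2 / t) = 8192 * d ^ 2 * δ ^ 4 := by rw [ht]; field_simp; ring
    have hpos : (0 : ℝ) ≤ 32 * d * δ ^ 2 := by positivity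
    have hI := mul_le_mul_of_nonneg_left I hpos
    have e1 : 32 * d * δ ^ 2 * (2 * t * ∑ x : TorusSite d N, ψ x ^ 2 * lap h x ^ 2 +
        2 / t * ∑ x : TorusSite d N, ψ x ^ 2 * h x ^ 2 +
        2 * ∑ i, ∑ x : TorusSite d N, fd i ψ x ^ 2 * (h x + h (x + Pi.single i 1)) ^ 2) =
        (32 * d * δ ^ 2 * (2 * t)) * ∑ x : TorusSite d N, ψ x ^ 2 * lap h x ^ 2 + (32 * d * δ ^ 2 * (2 / t)) * H +
        64 * d * δ ^ 2 * ∑ i, ∑ x : TorusSite d N, fd i ψ x ^ 2 * (h x + h (x + Pi.single i 1)) ^ 2 := by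
      rw [hH]; ring
    rw [e1, c1, c2] at hI
    have m1 : (1 / 2 : ℝ) * ∑ x : TorusSite d N, ψ x ^ 2 * lap h x ^ 2 ≤ (1 / 2) * EM :=
      mul_le_mul_of_nonneg_left L1 (by norm_num)
    have m2 : 8192 * (d : ℝ) ^ 2 * δ ^ 4 * H ≤ 8192 * d ^ 2 * δ ^ 4 * HM :=
      mul_le_mul_of_nonneg_left L2 (by positivity)
    have m3 : 64 * (d : ℝ) * δ ^ 2 * ∑ i, ∑ x : TorusSite d N, fd i ψ x ^ 2 * (h x + h (x + Pi.single i 1)) ^ 2 ≤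
        64 * d * δ ^ 2 * (4 * d * δ ^ 2 * HM) := mul_le_mul_of_nonneg_left L3 (by positivity)
    have e2 : 64 * (d : ℝ) * δ ^ 2 * (4 * d * δ ^ 2 * HM) = 256 * d ^ 2 * δ ^ 4 * HM := by ring
    linarith [hI, m1, m2, m3, e2]
  have c3 : 16 * (d : ℝ) ^ 2 * δ ^ 4 * H ≤ 16 * d ^ 2 * δ ^ 4 * HM :=
    mul_le_mul_of_nonneg_left L2 (by positivity)
  linarith [A, key, c3]

end Biharmonic

end Summit.QuantumFields.YangMills.Theorems.N07PlateCaccioppoliBiharmonic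

end
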